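import Summits.Ventures.PercRepro.RLSClosedForms

/-!
# C-025 at q = 3: closed forms of the t = 1 planar sums of the lifted rule R₃⁺ (night-3)

The `t = 1` companion of `RLSClosedForms` (outside points `p − 1 = n + 3`, `p = n + 4`): the R₃ share sum of a triple
`s0Sum n = Σ_x C(p−1,x)/C(x+3,3)`, the pure share sum of a 4-set `s1Sum n = Σ_x C(p−1,x)/C(x+4,3)` and the hard-max tie sum of a
near-pencil subset `tie1Sum n = Σ_x C(p−1,x)/(x+1)`, as powers of 2 and binomials (`s0_closed`, `s1_closed`, `tie1_closed`) and as
explicit rational functions of `n` and `2^n` (`s0P`, `s1P`, `tie1P`; `s0_eq_s0P`, `s1_eq_s1P`, `tie1_eq_tie1P`), with the cast lemmas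
`C(N,2) = N(N−1)/2`, `C(N,3) = N(N−1)(N−2)/6`, `C(N,4) = N(N−1)(N−2)(N−3)/24`.  Same proofs as at t = 2; no `decide`.
-/

open PercRepro.NightThree.CF

namespace PercRepro.NightThree.NP1

open Finset
/-! ## Closed forms of the t = 1 sums (outside points p − 1 = n + 3) -/

/-- `Σ_{y<3} C(N,y) = 1 + N + C(N,2)`. -/
theorem sum_range_three (N : ℕ) : (∑ y ∈ range 3, (N.choose y : ℚ)) = 1 + N + (N.choose 2 : ℚ) := by
  simp [sum_range_succ]

/-- The R₃ share sum of a triple at `t = 1`: `Σ_{x=1}^{p−4} C(p−1,x)/C(x+3,3)`. -/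
def s0Sum (n : ℕ) : ℚ := ∑ i ∈ range n, ((n + 3).choose (i + 1) : ℚ) / ((i + 4).choose 3 : ℚ)

/-- `s0Sum n = (2^{n+6} − (1 + (n+6) + C(n+6,2) + C(n+6,3)) − (1 + (n+6) + C(n+6,2))) / C(n+6,3)`. -/
theorem s0_closed (n : ℕ) :
    s0Sum n = (2 ^ (n + 6) - (1 + ((n : ℚ) + 6) + ((n + 6).choose 2 : ℚ) + ((n + 6).choose 3 : ℚ))
      - (1 + ((n : ℚ) + 6) + ((n + 6).choose 2 : ℚ))) / ((n + 6).choose 3 : ℚ) := by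
  have hpos : (((n + 6).choose 3 : ℕ) : ℚ) ≠ 0 := by exact_mod_cast (Nat.choose_pos (by omega)).ne'
  have hterm : ∀ i ∈ range n, ((n + 3).choose (i + 1) : ℚ) / ((i + 4).choose 3 : ℚ) =
      ((n + 6).choose (i + 4) : ℚ) / ((n + 6).choose 3 : ℚ) := by
    intro i _
    have hx : (((i + 4).choose 3 : ℕ) : ℚ) ≠ 0 := by exact_mod_cast (Nat.choose_pos (by omega)).ne'
    rw [div_eq_div_iff hx hpos]
    have h := Nat.choose_mul (n := n + 6) (k := i + 4) (s := 3) (by omega)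
    rw [show n + 6 - 3 = n + 3 by omega, show i + 4 - 3 = i + 1 by omega] at h
    have h' : ((n + 6).choose (i + 4) : ℚ) * ((i + 4).choose 3 : ℚ) = ((n + 6).choose 3 : ℚ) * ((n + 3).choose (i + 1) : ℚ) := by
      exact_mod_cast h
    linear_combination -h'
  unfold s0Sum
  rw [sum_congr rfl hterm, ← sum_div, sum_choose_shift (n + 6) 4 n, sum_choose_Ico (n + 6) 4 (4 + n) (by omega) (by omega)]
  have ht := sum_choose_tail (n + 6) 3 (by omega)
  rw [show n + 6 + 1 - 3 = 4 + n by omega] at ht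
  rw [ht, sum_range_four, sum_range_three]
  congr 1
  push_cast
  ring

/-- The pure R₃ share sum of a 4-set at `t = 1`: `Σ_{x=1}^{p−4} C(p−1,x)/C(x+4,3)`. -/
def s1Sum (n : ℕ) : ℚ := ∑ i ∈ range n, ((n + 3).choose (i + 1) : ℚ) / ((i + 5).choose 3 : ℚ)

/-- Termwise: `C(n+3,i+1)/C(i+5,3) = C(n+3,i+1)/C(i+4,3) − (3/4)·C(n+7,i+5)/C(n+7,4)`. -/
theorem s1_term (n i : ℕ) :
    ((n + 3).choose (i + 1) : ℚ) / ((i + 5).choose 3 : ℚ) =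
      ((n + 3).choose (i + 1) : ℚ) / ((i + 4).choose 3 : ℚ) - 3 / 4 * (((n + 7).choose (i + 5) : ℚ) / ((n + 7).choose 4 : ℚ)) := by
  have hP : (((i + 4).choose 3 : ℕ) : ℚ) ≠ 0 := by exact_mod_cast (Nat.choose_pos (by omega)).ne'
  have hQ : (((i + 5).choose 3 : ℕ) : ℚ) ≠ 0 := by exact_mod_cast (Nat.choose_pos (by omega)).ne'
  have hV : (((n + 7).choose 4 : ℕ) : ℚ) ≠ 0 := by exact_mod_cast (Nat.choose_pos (by omega)).ne'
  have ha0 := Nat.choose_mul (n := n + 7) (k := i + 5) (s := 4) (by omega)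
  rw [show n + 7 - 4 = n + 3 by omega, show i + 5 - 4 = i + 1 by omega] at ha0
  have ha : ((n + 7).choose (i + 5) : ℚ) * ((i + 5).choose 4 : ℚ) = ((n + 7).choose 4 : ℚ) * ((n + 3).choose (i + 1) : ℚ) := by
    exact_mod_cast ha0
  have hb0 := Nat.choose_succ_right_eq (i + 5) 3
  rw [show i + 5 - 3 = i + 2 by omega] at hb0
  have hb : ((i + 5).choose 4 : ℚ) * 4 = ((i + 5).choose 3 : ℚ) * ((i : ℚ) + 2) := by exact_mod_cast hb0
  have hc0 := Nat.choose_succ_succ' (i + 4) 2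
  have hc : ((i + 5).choose 3 : ℚ) = ((i + 4).choose 2 : ℚ) + ((i + 4).choose 3 : ℚ) := by
    rw [show i + 5 = i + 4 + 1 by omega]; exact_mod_cast hc0
  have hd0 := Nat.choose_succ_right_eq (i + 4) 2
  rw [show i + 4 - 2 = i + 2 by omega] at hd0
  have hd : ((i + 4).choose 3 : ℚ) * 3 = ((i + 4).choose 2 : ℚ) * ((i : ℚ) + 2) := by exact_mod_cast hd0
  have h4V : (4 : ℚ) * ((n + 7).choose 4 : ℚ) ≠ 0 := mul_ne_zero (by norm_num) hV
  rw [eq_sub_iff_add_eq, div_mul_div_comm, div_add_div _ _ hQ h4V, div_eq_div_iff (mul_ne_zero hQ h4V) hP]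
  linear_combination (-(4 * ((n + 3).choose (i + 1) : ℚ) * ((n + 7).choose 4 : ℚ))) * hc
    + 4 * ((i + 4).choose 2 : ℚ) * ha - ((n + 7).choose (i + 5) : ℚ) * ((i + 4).choose 2 : ℚ) * hb
    + ((n + 7).choose (i + 5) : ℚ) * ((i + 5).choose 3 : ℚ) * hd

/-- `s1Sum n = s0Sum n − 3·(2^{n+7} − (1 + (n+7) + C(n+7,2) + C(n+7,3) + C(n+7,4)) − (1 + (n+7) + C(n+7,2))) / (4·C(n+7,4))`. -/
theorem s1_closed (n : ℕ) :
    s1Sum n = s0Sum n - 3 * (2 ^ (n + 7) - (1 + ((n : ℚ) + 7) + ((n + 7).choose 2 : ℚ) + ((n + 7).choose 3 : ℚ)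
      + ((n + 7).choose 4 : ℚ)) - (1 + ((n : ℚ) + 7) + ((n + 7).choose 2 : ℚ))) / (4 * ((n + 7).choose 4 : ℚ)) := by
  have hV : (((n + 7).choose 4 : ℕ) : ℚ) ≠ 0 := by exact_mod_cast (Nat.choose_pos (by omega)).ne'
  unfold s1Sum s0Sum
  rw [sum_congr rfl (fun i _ => s1_term n i), sum_sub_distrib, ← mul_sum, ← sum_div]
  rw [sum_choose_shift (n + 7) 5 n, sum_choose_Ico (n + 7) 5 (5 + n) (by omega) (by omega)]
  have ht := sum_choose_tail (n + 7) 3 (by omega)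
  rw [show n + 7 + 1 - 3 = 5 + n by omega] at ht
  rw [ht, sum_range_five, sum_range_three]
  congr 1
  field_simp
  push_cast
  ring

/-- The hard-max tie sum of a near-pencil subset at `t = 1`: `Σ_{x=1}^{p−4} C(p−1,x)/(x+1)`. -/
def tie1Sum (n : ℕ) : ℚ := ∑ i ∈ range n, ((n + 3).choose (i + 1) : ℚ) / ((i : ℚ) + 2)

/-- `tie1Sum n = (2^{n+4} − (1 + (n+4)) − (1 + (n+4) + C(n+4,2))) / (n+4)`. -/
theorem tie1_closed (n : ℕ) :
    tie1Sum n = (2 ^ (n + 4) - (1 + ((n : ℚ) + 4)) - (1 + ((n : ℚ) + 4) + ((n + 4).choose 2 : ℚ))) / ((n : ℚ) + 4) := by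
  have hn : ((n : ℚ) + 4) ≠ 0 := by positivity
  have hterm : ∀ i ∈ range n, ((n + 3).choose (i + 1) : ℚ) / ((i : ℚ) + 2) =
      ((n + 4).choose (i + 2) : ℚ) / ((n : ℚ) + 4) := by
    intro i _
    have hi : ((i : ℚ) + 2) ≠ 0 := by positivity
    rw [div_eq_div_iff hi hn]
    have h := Nat.add_one_mul_choose_eq (n + 3) (i + 1)
    rw [show n + 3 + 1 = n + 4 by omega, show i + 1 + 1 = i + 2 by omega] at h
    have h' : ((n : ℚ) + 4) * ((n + 3).choose (i + 1) : ℚ) = ((n + 4).choose (i + 2) : ℚ) * ((i : ℚ) + 2) := by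
      exact_mod_cast h
    linear_combination h'
  unfold tie1Sum
  rw [sum_congr rfl hterm, ← sum_div, sum_choose_shift (n + 4) 2 n, sum_choose_Ico (n + 4) 2 (2 + n) (by omega) (by omega)]
  have ht := sum_choose_tail (n + 4) 3 (by omega)
  rw [show n + 4 + 1 - 3 = 2 + n by omega] at ht
  rw [ht, sum_range_two, sum_range_three]
  congr 1
  push_cast
  ring

/-! ## Polynomial forms -/

/-- `C(N,2) = N(N−1)/2` in `ℚ`. -/
theorem choose_two_cast (N : ℕ) : (N.choose 2 : ℚ) = (N : ℚ) * ((N : ℚ) - 1) / 2 := by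
  induction N with
  | zero => simp
  | succ m ih =>
    rw [Nat.choose_succ_succ', Nat.choose_one_right]
    push_cast
    rw [ih]; ring

/-- `C(N,3) = N(N−1)(N−2)/6` in `ℚ`. -/
theorem choose_three_cast (N : ℕ) : (N.choose 3 : ℚ) = (N : ℚ) * ((N : ℚ) - 1) * ((N : ℚ) - 2) / 6 := by
  induction N with
  | zero => simp
  | succ m ih =>
    rw [Nat.choose_succ_succ']
    push_cast
    rw [ih, choose_two_cast]; ring

/-- `C(N,4) = N(N−1)(N−2)(N−3)/24` in `ℚ`. -/
theorem choose_four_cast (N : ℕ) : (N.choose 4 : ℚ) = (N : ℚ) * ((N : ℚ) - 1) * ((N : ℚ) - 2) * ((N : ℚ) - 3) / 24 := by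
  induction N with
  | zero => simp
  | succ m ih =>
    rw [Nat.choose_succ_succ']
    push_cast
    rw [ih, choose_three_cast]; ring

/-- `s0Sum` as a rational function. -/
def s0P (n : ℕ) : ℚ :=
  (64 * 2 ^ n - (2 + 2 * ((n : ℚ) + 6) + 2 * (((n : ℚ) + 6) * ((n : ℚ) + 5) / 2) + ((n : ℚ) + 6) * ((n : ℚ) + 5) * ((n : ℚ) + 4) / 6)) /
    (((n : ℚ) + 6) * ((n : ℚ) + 5) * ((n : ℚ) + 4) / 6)

/-- `s1Sum` as a rational function. -/
def s1P (n : ℕ) : ℚ :=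
  s0P n - 3 * (128 * 2 ^ n - (2 + 2 * ((n : ℚ) + 7) + 2 * (((n : ℚ) + 7) * ((n : ℚ) + 6) / 2)
      + ((n : ℚ) + 7) * ((n : ℚ) + 6) * ((n : ℚ) + 5) / 6 + ((n : ℚ) + 7) * ((n : ℚ) + 6) * ((n : ℚ) + 5) * ((n : ℚ) + 4) / 24)) /
    (4 * (((n : ℚ) + 7) * ((n : ℚ) + 6) * ((n : ℚ) + 5) * ((n : ℚ) + 4) / 24))

/-- `tie1Sum` as a rational function. -/
def tie1P (n : ℕ) : ℚ := (16 * 2 ^ n - (2 + 2 * ((n : ℚ) + 4) + ((n : ℚ) + 4) * ((n : ℚ) + 3) / 2)) / ((n : ℚ) + 4)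

/-- `s0Sum` as an explicit rational function. -/
theorem s0_eq_s0P (n : ℕ) : s0Sum n = s0P n := by
  rw [s0_closed]; unfold s0P
  rw [choose_three_cast, choose_two_cast]
  push_cast
  rw [pow_add]
  ring_nf

/-- `s1Sum` as an explicit rational function. -/
theorem s1_eq_s1P (n : ℕ) : s1Sum n = s1P n := by
  rw [s1_closed, s0_eq_s0P]; unfold s1P
  rw [choose_four_cast, choose_three_cast, choose_two_cast]
  push_cast
  rw [pow_add]
  ring_nf

/-- `tie1Sum` as an explicit rational function. -/
theorem tie1_eq_tie1P (n : ℕ) : tie1Sum n = tie1P n := by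
  rw [tie1_closed]; unfold tie1P
  rw [choose_two_cast]
  push_cast
  rw [pow_add]
  ring_nf


end PercRepro.NightThree.NP1
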